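import Summits.Ventures.PercRepro.S2TopCountCell
import Summits.Ventures.PercRepro.S2NullityDescent

/-!
# PercRepro — S2: THE SPREAD HALF OF THE `(16, 7)` DICHOTOMY, AND THE CELL `(16, 7)` ON THE COLOOP-FREE CORE (p7, gen 10; sub-claim S2; the `p = 16` row)

The concentrated half (S2PaymentSixteenSeven / S2NullityDescent) closes `(16, 7)` on every core carrying a set `W` with
`(ν(W), |W|) ∈ {(6, ≤ 18), (5, ≤ 14), (4, ≤ 9)}`. On a SPREAD core — no such `W` — every set of rank `≤ r` (`r ≤ 5`) has
`≤ r + 3` points (**`S2.ncard_le_of_eRk_le_of_not_concentrated`**: a rank-`≤ r` set with `≥ r + 4` points has nullity `≥ 4`, and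
the nullity descent inside it produces a `W'` of nullity `4 / 5 / 6` on `≤ r + 4 / r + 5 / r + 6 ≤ 9 / 10 / 11` points). So every rank-`5`
set has `≤ 8` points and every rank-`4` set `≤ 7`: the kit's own partition count (`S2.ncard_eRk_eq_ncard_le_le_sets_indep_quart`
with `f = 8`, `f' = 7`) charges the `7`-element rank-`5` sets `2/5` of the spanning `6`-sets instead of `1`
(`|cl S ∖ S| ≤ 2`), and the giant term vanishes: `#U(16, 5) ≤ C(23, 5) + C(11, 2) + (7/5)·(11·C(20, 3) + 46·C(19, 2) + 299·18 + C(12, 6))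
= 33,704 + 37,396.8` (**`ThmN.topCount_le_spread_sixteen_seven`**: `#U ≤ 71,101`), against the cell's need `76,149` (the kit's own
`Φ ≤ 2^21/C(21, 5)`, slack `66/1024`): **`ThmN.c025_sixteen_seven_of_spread`**. The two halves together:
**`ThmN.c025_sixteen_seven_coloop_free`** — `RLS M 16 5` on every `e`-free core of rank `16` on `23` points without coloops,
no further hypothesis. Axioms: standard.
-/

open scoped Matroid

namespace PercRepro

namespace S2

open Set

variable {α : Type}

/-- **The flat bound on a spread core**: if no `W ⊆ E` has `(ν(W), |W|) ∈ {(6, ≤ 18), (5, ≤ 14), (4, ≤ 9)}`, then every set of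
rank `≤ r ≤ 5` has at most `r + 3` points (nullity descent inside a set of nullity `≥ 4`). -/
theorem ncard_le_of_eRk_le_of_not_concentrated (M : Matroid α) [M.Finite]
    (hns : ¬ ∃ W ⊆ M.E, (W.ncard ≤ 18 ∧ W.encard = M.eRk W + 6) ∨ (W.ncard ≤ 14 ∧ W.encard = M.eRk W + 5) ∨
      (W.ncard ≤ 9 ∧ W.encard = M.eRk W + 4))
    {X : Set α} (hX : X ⊆ M.E) {r : ℕ} (hr5 : r ≤ 5) (hXr : M.eRk X ≤ r) : X.ncard ≤ r + 3 := by
  classical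
  by_contra hbig
  push Not at hbig
  have hXfin : X.Finite := M.ground_finite.subset hX
  -- descent with `k`: a `W' ⊆ X` of nullity `k` has `≤ r + k` points
  have key : ∀ k : ℕ, r + k ≤ X.ncard → ∃ W' ⊆ M.E, W'.ncard ≤ r + k ∧ W'.encard = M.eRk W' + k := by
    intro k hk
    have hk' : M.eRk X + k ≤ X.encard := by
      calc M.eRk X + k ≤ (r : ℕ∞) + k := by gcongr
        _ = ((r + k : ℕ) : ℕ∞) := by push_cast; rfl
        _ ≤ (X.ncard : ℕ∞) := by exact_mod_cast hk
        _ = X.encard := hXfin.cast_ncard_eq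
    obtain ⟨W', hW'X, hW'⟩ := exists_subset_encard_eq_eRk_add M hX k hk'
    have hW'fin : W'.Finite := hXfin.subset hW'X
    refine ⟨W', hW'X.trans hX, ?_, hW'⟩
    have h1 : W'.encard ≤ ((r + k : ℕ) : ℕ∞) := by
      rw [hW']
      calc M.eRk W' + k ≤ M.eRk X + k := by gcongr; exact M.eRk_mono hW'X
        _ ≤ (r : ℕ∞) + k := by gcongr
        _ = ((r + k : ℕ) : ℕ∞) := by push_cast; rfl
    rw [← hW'fin.cast_ncard_eq] at h1
    exact_mod_cast h1
  apply hns
  rcases Nat.lt_or_ge X.ncard (r + 5) with h4 | h56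
  · -- `|X| = r + 4`: nullity `≥ 4` on `≤ 9` points
    obtain ⟨W', hW'E, hW'n, hW'⟩ := key 4 (by omega)
    exact ⟨W', hW'E, Or.inr (Or.inr ⟨by omega, hW'⟩)⟩
  rcases Nat.lt_or_ge X.ncard (r + 6) with h5 | h6
  · obtain ⟨W', hW'E, hW'n, hW'⟩ := key 5 (by omega)
    exact ⟨W', hW'E, Or.inr (Or.inl ⟨by omega, hW'⟩)⟩
  · obtain ⟨W', hW'E, hW'n, hW'⟩ := key 6 (by omega)
    exact ⟨W', hW'E, Or.inl ⟨by omega, hW'⟩⟩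

end S2

namespace ThmN

open Set

variable {α : Type}

/-- **The top count on a spread `(16, 7)` core**: if every rank-`5` set has `≤ 8` points and every rank-`4` set `≤ 7`, then
`#U(16, 5) ≤ 71,101` (the kit's partition count with `f = 8`, `f' = 7`: the `7`-sets weigh `2/5`, no giant term; the independent
`5`-sets `≤ C(23, 5) + C(11, 2)`; the caps `11 / 46 / 299` and `s₆ ≤ C(12, 6)`). -/
theorem topCount_le_spread_sixteen_seven (M : Matroid α) [M.Finite]
    (hR : M.eRank = ((16 : ℕ) : ℕ∞)) (hn : M.E.ncard = 16 + 7)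
    (hfree : ∀ e ∈ M.E, ∃ A ⊆ M.E \ {e}, e ∉ M.closure A ∧ e ∉ M.closure ((M.E \ {e}) \ A))
    (hK : ∀ e, ¬ M.IsColoop e)
    (hflat : ∀ X ⊆ M.E, M.eRk X ≤ 5 → X.ncard ≤ 8)
    (hflat' : ∀ X ⊆ M.E, M.eRk X ≤ 4 → X.ncard ≤ 7) :
    Matroid.topCount M 16 5 ≤ 71101 := by
  classical
  have hL0 : ∀ e ∈ M.E, ¬ M.IsLoop e := not_isLoop_of_free M hfree
  have hs : ∀ e ∈ M.E, ∀ f ∈ M.E, e ≠ f → M.eRk {e, f} = 2 := by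
    intro e he f hf hef
    have h2 : (2 : ℕ∞) ≤ M.eRk {e, f} :=
      two_le_eRk_of_two_le_ncard_of_free M hfree (pair_subset he hf) (by rw [ncard_pair hef])
    have h3 : M.eRk {e, f} ≤ 2 := by
      have := M.eRk_le_encard {e, f}
      rwa [encard_pair hef] at this
    exact le_antisymm h3 h2
  have hcirc : ∀ C, M.IsCircuit C → 3 ≤ C.encard := three_le_encard_of_circuit M hL0 hs
  have hd : M.E.encard = M.eRank + ((7 : ℕ) : ℕ∞) := by
    rw [hR, ← M.ground_finite.cast_ncard_eq, hn]
    push_cast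
    ring
  have hC1 : ∀ L ⊆ M.E, M.eRk L = 2 → L.ncard ≤ 3 :=
    fun L hL hr => ncard_le_three_of_eRk_two M hs hfree hL hr
  have hC2 : ∀ P ⊆ M.E, M.eRk P ≤ 3 → P.ncard ≤ 6 :=
    fun P hP hr => ncard_le_six_of_eRk_le_three_of_free M hfree hP hr
  have hs6 : {C | M.IsCircuit C ∧ C.ncard = 6}.ncard ≤ (7 + 5).choose 6 :=
    Matroid.ncard_circuits_le_choose_of_encard M hd 5
  -- the caps at `(16, 7)` on a coloop-free core
  have hs3 := TriangleCap.core_ncard_triangles_le_cq3 M hfree hd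
  rw [show TriangleCap.cq3 7 = 11 by decide] at hs3
  have hcol : M.coloops = ∅ := S2.coloops_eq_empty_of_forall_not M hK
  have hs4' := S2.ncard_fourCircuits_le_of_seven_free_of_card M hfree (by exact_mod_cast hd) hn (by norm_num) hcol
    (fun M' _ hfree' hd5 => ncard_fourCircuits_le_avgChain16 5 M' hfree' hd5)
  have hs4 : {C : Set α | M.IsCircuit C ∧ C.ncard = 4}.ncard ≤ 46 := by
    rcases hs4' with h | h
    · exact h
    · norm_num at h
      omega
  have hd6 : M.E.encard = M.eRank + (((6 : ℕ) : ℕ∞) + 1) := by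
    rw [hd]; norm_num
  have hs5 := S2.ncard_fiveCircuits_le_of_no_coloop M hfree hd6 hK (by omega)
  rw [hn] at hs5
  have h299 : (16 + 7) * S1.avgChain5b 6 / (16 + 7 - 5) = 299 := by decide
  rw [h299] at hs5
  -- the partition count with `f = 8`, `f' = 7`
  have hflat'' : ∀ X ⊆ M.E, M.eRk X ≤ ((5 - 1 : ℕ) : ℕ∞) → X.ncard ≤ 7 := fun X hX hr =>
    hflat' X hX (by simpa using hr)
  have hU0 := S2.ncard_eRk_eq_ncard_le_le_sets_indep_quart M 5 8 7 7 6 7 (by norm_num)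
    hcirc hC1 hC2 hflat hflat'' (hinter_five M hfree) hd (by omega) (by omega) (by omega)
  have hU1 := Matroid.topCount_le_ncard_compl (M := M) hR hd 5
  simp only [show (5 : ℕ) + 1 = 6 from rfl] at hU0
  rw [hn, sum_Icc_three_six_q] at hU0
  simp only [show (6 : ℕ) - 3 = 3 from rfl, show (6 : ℕ) - 4 = 2 from rfl,
    show (6 : ℕ) - 5 = 1 from rfl, show (6 : ℕ) - 6 = 0 from rfl, Nat.choose_one_right,
    Nat.choose_zero_right] at hU0
  norm_num [Finset.sum_range_succ, Nat.choose] at hU0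
  -- the independent `5`-sets against the triangles
  have hI5 := S2.ncard_indep_five_add_le (M := M) hC1
  rw [hn] at hI5
  have hch : ({C : Set α | M.IsCircuit C ∧ C.ncard = 3}.ncard).choose 2 ≤ (11 : ℕ).choose 2 :=
    Nat.choose_le_choose 2 hs3
  have hI5' : {B : Set α | B ⊆ M.E ∧ B.ncard = 5 ∧ M.eRk B = 5}.ncard ≤ 33704 := by
    have h1 : (16 + 7).choose 5 = 33649 := by decide
    have h2 : (11 : ℕ).choose 2 = 55 := by decide
    omega
  -- assemble in `ℚ`
  have hU1q : (Matroid.topCount M 16 5 : ℚ) ≤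
      ({B : Set α | B ⊆ M.E ∧ M.eRk B = 5 ∧ B.ncard ≤ 7}.ncard : ℚ) := by exact_mod_cast hU1
  have hI5q : ({B : Set α | B ⊆ M.E ∧ B.ncard = 5 ∧ M.eRk B = 5}.ncard : ℚ) ≤ 33704 := by exact_mod_cast hI5'
  have hs3q : ({C : Set α | M.IsCircuit C ∧ C.ncard = 3}.ncard : ℚ) ≤ 11 := by exact_mod_cast hs3
  have hs4q : ({C : Set α | M.IsCircuit C ∧ C.ncard = 4}.ncard : ℚ) ≤ 46 := by exact_mod_cast hs4
  have hs5q : ({C : Set α | M.IsCircuit C ∧ C.ncard = 5}.ncard : ℚ) ≤ 299 := by exact_mod_cast hs5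
  have hs6q : ({C : Set α | M.IsCircuit C ∧ C.ncard = 6}.ncard : ℚ) ≤ 924 := by
    have h : (7 + 5).choose 6 = 924 := by decide
    rw [h] at hs6
    exact_mod_cast hs6
  have hfin : (Matroid.topCount M 16 5 : ℚ) ≤ 71101 := by
    linarith [hU1q, hU0, hI5q, hs3q, hs4q, hs5q, hs6q]
  exact_mod_cast hfin

/-- **The cell `(16, 7)` on a spread core**: every rank-`5` set `≤ 8` points and every rank-`4` set `≤ 7` points give
`RLS M 16 5` (the `(U)`-side `71,101` against `76,149`; caps `11 / 46 / 299`, slack `66/1024`, `Φ(16, 5) ≤ 2^21/C(21, 5)`). -/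
theorem c025_sixteen_seven_of_spread (M : Matroid α) [M.Finite]
    (hR : M.eRank = ((16 : ℕ) : ℕ∞)) (hn : M.E.ncard = 16 + 7)
    (hfree : ∀ e ∈ M.E, ∃ A ⊆ M.E \ {e}, e ∉ M.closure A ∧ e ∉ M.closure ((M.E \ {e}) \ A))
    (hK : ∀ e, ¬ M.IsColoop e)
    (hflat : ∀ X ⊆ M.E, M.eRk X ≤ 5 → X.ncard ≤ 8)
    (hflat' : ∀ X ⊆ M.E, M.eRk X ≤ 4 → X.ncard ≤ 7) : RLS M 16 5 := by
  classical
  have hd : M.E.encard = M.eRank + ((7 : ℕ) : ℕ∞) := by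
    rw [hR, ← M.ground_finite.cast_ncard_eq, hn]
    push_cast
    ring
  have hs3 := TriangleCap.core_ncard_triangles_le_cq3 M hfree hd
  rw [show TriangleCap.cq3 7 = 11 by decide] at hs3
  have hcol : M.coloops = ∅ := S2.coloops_eq_empty_of_forall_not M hK
  have hs4' := S2.ncard_fourCircuits_le_of_seven_free_of_card M hfree (by exact_mod_cast hd) hn (by norm_num) hcol
    (fun M' _ hfree' hd5 => ncard_fourCircuits_le_avgChain16 5 M' hfree' hd5)
  have hs4 : {C : Set α | M.IsCircuit C ∧ C.ncard = 4}.ncard ≤ 46 := by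
    rcases hs4' with h | h
    · exact h
    · norm_num at h
      omega
  have hd6 : M.E.encard = M.eRank + (((6 : ℕ) : ℕ∞) + 1) := by
    rw [hd]; norm_num
  have hs5 := S2.ncard_fiveCircuits_le_of_no_coloop M hfree hd6 hK (by omega)
  rw [hn] at hs5
  have h299 : (16 + 7) * S1.avgChain5b 6 / (16 + 7 - 5) = 299 := by decide
  rw [h299] at hs5
  have hU := topCount_le_spread_sixteen_seven M hR hn hfree hK hflat hflat'
  refine c025_core_five_cell_of_topCount_xqictq5 M 16 7 (by norm_num) hR hn hfree 11 46 299 hs3 hs4 hs5 71101 hU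
    ⟨66, by norm_num, ?_, ?_⟩
  · norm_num [Nat.choose]
  · have hsm : (∑ j ∈ Finset.range (7), (Nat.choose (min 13 ((7 + 6) / 2 + 1 - 2)) j : ℚ) / (((j + 1) + 3 * (j + 1).choose 2 + 3 * (j + 1).choose 3 + 2 * (j + 1).choose 4 : ℕ) : ℚ)) = 12767 / 4230 := by
      norm_num [Finset.sum_range_succ, Nat.choose]
    have hsg : (∑ j ∈ Finset.range (7), (Nat.choose (min 19 (5 + 7) - 6) j : ℚ) / (((j + 1) + 3 * (j + 1).choose 2 + 3 * (j + 1).choose 3 + 2 * (j + 1).choose 4 : ℕ) : ℚ)) = 414767 / 103635 := by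
      norm_num [Finset.sum_range_succ, Nat.choose]
    have hs4m : (∑ j ∈ Finset.range 6, (Nat.choose (min 5 ((7 + 3) / 2 + 1 - 2)) j : ℚ) / (((j + 1) + 3 * (j + 1).choose 2 + 3 * (j + 1).choose 3 + 2 * (j + 1).choose 4 : ℕ) : ℚ)) = 523 / 225 := by
      norm_num [Finset.sum_range_succ, Nat.choose]
    have hs4g : (∑ j ∈ Finset.range 6, (Nat.choose 5 j : ℚ) / (((j + 1) + 3 * (j + 1).choose 2 + 3 * (j + 1).choose 3 + 2 * (j + 1).choose 4 : ℕ) : ℚ)) = 12767 / 4230 := by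
      norm_num [Finset.sum_range_succ, Nat.choose]
    rw [hsm, hsg, hs4m, hs4g]
    simp only [Finset.sum_range_succ, Finset.sum_range_zero]
    norm_num [Nat.choose]

/-- **THE CELL `(16, 7)` ON THE COLOOP-FREE `e`-FREE CORE**: `RLS M 16 5` for every finite matroid of rank `16` on `23` points
that is `e`-free and has no coloop — concentrated (a set `W` with `(ν(W), |W|) ∈ {(6, ≤ 18), (5, ≤ 14), (4, ≤ 9)}`: the nullity
payment) or spread (no such `W`: every rank-`5` set has `≤ 8` points, the kit's count with `f = 8`). -/
theorem c025_sixteen_seven_coloop_free (M : Matroid α) [M.Finite]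
    (hR : M.eRank = ((16 : ℕ) : ℕ∞)) (hn : M.E.ncard = 16 + 7)
    (hfree : ∀ e ∈ M.E, ∃ A ⊆ M.E \ {e}, e ∉ M.closure A ∧ e ∉ M.closure ((M.E \ {e}) \ A))
    (hK : ∀ e, ¬ M.IsColoop e) : RLS M 16 5 := by
  classical
  by_cases hc : ∃ W ⊆ M.E, (W.ncard ≤ 18 ∧ W.encard = M.eRk W + 6) ∨ (W.ncard ≤ 14 ∧ W.encard = M.eRk W + 5) ∨
      (W.ncard ≤ 9 ∧ W.encard = M.eRk W + 4)
  · exact c025_sixteen_seven_of_concentrated M hR hn hfree hK hc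
  · exact c025_sixteen_seven_of_spread M hR hn hfree hK
      (fun X hX hr => S2.ncard_le_of_eRk_le_of_not_concentrated M hc hX (by norm_num) hr)
      (fun X hX hr => S2.ncard_le_of_eRk_le_of_not_concentrated M hc hX (by norm_num) hr)

end ThmN

end PercRepro
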